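import Literature.IUT.HodgeTheaters.GlobalFrobenioids
import Literature.IUT.HodgeTheaters.GlobalFrobenioidsModel
import Literature.IUT.HodgeTheaters.GlobalFrobenioidsKummer
import HarnessLib

/-!
# [IUTchI] Example 5.1 (iv), (v) — complements: the `†𝕄^⊛`-case of the cyclotome rigidity,
# Kummer-determined uniqueness of coric structures, invertible elements of pseudo-monoids

Mochizuki, *Inter-universal Teichmüller theory I*, §5, Example 5.1 "Global Frobenioids", kurims
manuscript (May 2020), (iv) p. 126, (v) pp. 127–128 ([IUTchI] Ex 5.1 (iv)(v) pp.126–128)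
[claim: Mochizuki2012, status: disputed].  STATEMENTS-FIRST; nothing of the disputed content is
asserted.  This file COMPLETES the sibling files `GlobalFrobenioids.lean` (i),
`GlobalFrobenioidsModel.lean` (ii)–(iv),(vi), `GlobalFrobenioidsKummer.lean` (v),(vii) — which are not
modified — with clauses those files compress (referee pass G7, observations G7-O2/G7-O4; RQ7 remark
R1); the p. 129–130 complements are in `GlobalFrobenioidsInfKappa.lean`.

* §0 p. 33 / (v) p. 128 "the superscript `×` [denotes] the subset of invertible elements of a
  pseudo-monoid": `PartialMul.IsNeutral`, `PartialMul.units` (REAL, intrinsic to the partial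
  multiplication), computed under a realisation `ι : P ↪ M` (`mem_units_iff`: invertible iff
  `1 ∈ ι(P)` and `ι(x)⁻¹ ∈ ι(P)`); the display `(𝕄^⊛_∞κ(†𝒟^⊚))^× ⊆ (𝕄^⊛_∞κ×(†𝒟^⊚))^× = 𝕄^⊛(†𝒟^⊚)`
  (p. 128) on the data of (i): the inclusion PROVED (`NFBridgeRecon.minfκUnits_subset`), the
  equality a predicate (`NFBridgeRecon.InfκxUnitsEqConstants`).
* (iv) p. 126 "a *closed* subgroup [well-defined up to conjugation] `Π_{𝔭₀} ⊆ π₁(†𝒟^⊛)`":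
  `BirationalData.IsClosedDecomp` (G7-O2; the sibling's `decomp` field does not record closedness).
* (v) p. 128, second display (G7-O4): "there exists a unique isomorphism of cyclotomes
  `μ^Θ_Ẑ(π₁(†𝒟^⊚)) ⥲ μ_Ẑ(†𝕄^⊛)` such that the resulting isomorphism between direct limits of
  cohomology modules induces isomorphisms `𝕄^⊛(†𝒟^⊚) ⥲ †𝕄^⊛`, `𝕄^⊛_sol(†𝒟^⊚) ⥲ †𝕄^⊛_sol`,
  `𝕄^⊛_mod(†𝒟^⊚) ⥲ †𝕄^⊛_mod` … in a fashion that is compatible with the integral submonoids `𝒪^⊿_𝔭`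
  [cf. (iv)], relative to the ring structure constructed in [AbsTopIII], Theorem 1.9, (e), on the
  domains": `CyclotomeComparisonFamily` (matched FAMILIES of sub-objects, here indexed by
  `AstLayer = {⊛, sol, mod}`, and of integral submonoids indexed by a set of primes `𝔓`) and
  `UniqueCyclotomeIsoFamily` (`∃!` over the whole such-that clause); `component` recovers the
  sibling's one-subset `CyclotomeComparison`, and `UniqueCyclotomeIsoFamily.of_component` (PROVED):
  uniqueness for one layer plus existence of a compatible isomorphism give the family statement.
* (v) p. 128, boxed display "`†ℱ^⊛` always admits an ∞κ-coric structure, unique up to a uniquely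
  determined isomorphism": the sibling renders the uniqueness as absolute rigidity of the model pair
  (`ExistsUniqueCoricStructure.subsingleton_iso`, a sufficient form).  Print DERIVES it from the
  Kummer embeddings `†𝕄^⊛_∞κ ↪ lim_H H¹(H, μ_Ẑ(†𝕄^⊛_∞κ))` (p. 127) transported by the unique
  cyclotome isomorphisms; this file types that derivation and PROVES its logic:
  `CoricPair.KummerRealization` (an equivariant realisation of the pair in a `Γ`-module, §0) and
  `CoricPair.KummerRealization.existsUnique_iso` — two pairs realised in the same container with
  the same image are related by EXACTLY ONE isomorphism of pairs compatible with the realisations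
  (RQ7 R1's "faithful fallback", now a theorem; no side taken on whether the model pair is
  absolutely rigid).
No printed statement is strengthened; no side is taken.
-/

namespace Literature.IUT.HodgeTheaters

open Pointwise

universe w' w u

/-! ### Invertible elements of a pseudo-monoid (§0 p. 33; Ex. 5.1 (v) p. 128) -/

section Units

variable {P : Type u}

/-- An element `e` of a pseudo-monoid is *neutral* if `e · y = y` for some `y` with `(e, y)` in the
domain [under any realisation `ι : P ↪ M`: `ι(e) = 1`, cf. `isNeutral_iff`]. ([IUTchI] §0 p.33)
[claim: Mochizuki2012, status: disputed] -/
def PartialMul.IsNeutral (μ : PartialMul P) (e : P) : Prop :=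
  ∃ (y : P) (h : (e, y) ∈ μ.dom), μ.op ⟨(e, y), h⟩ = y

/-- "The superscript `×` [denotes] the subset of invertible elements of a pseudo-monoid" (Ex. 5.1
(v) p. 128; (i) p. 124): `x ∈ P^×` iff `x · y` is defined and neutral for some `y ∈ P`.
([IUTchI] Ex 5.1 (v) p.128) [claim: Mochizuki2012, status: disputed] -/
def PartialMul.units (μ : PartialMul P) : Set P :=
  {x | ∃ (y : P) (h : (x, y) ∈ μ.dom), μ.IsNeutral (μ.op ⟨(x, y), h⟩)}

variable {μ : PartialMul P} {M : Type u} [CommGroup M] {ι : P → M}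

/-- Under a realisation `ι : P ↪ M`, `e` is neutral iff `ι(e) = 1`. ([IUTchI] §0 p.33)
[claim: Mochizuki2012, status: disputed] -/
theorem PartialMul.IsRealizedBy.isNeutral_iff (hι : μ.IsRealizedBy M ι) (e : P) :
    μ.IsNeutral e ↔ ι e = 1 := by
  constructor
  · rintro ⟨y, h, hy⟩
    have key : ι (μ.op ⟨(e, y), h⟩) = ι e * ι y := hι.op_eq _
    rw [hy] at key
    simpa using key.symm
  · intro he
    have hd : (e, e) ∈ μ.dom := by
      rw [hι.dom_eq]
      change ι e * ι e ∈ Set.range ι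
      rw [he, one_mul]
      exact ⟨e, he⟩
    refine ⟨e, hd, hι.injective ?_⟩
    have key : ι (μ.op ⟨(e, e), hd⟩) = ι e * ι e := hι.op_eq _
    rw [key, he, one_mul]

/-- Under a realisation `ι : P ↪ M`, `x` is invertible in the pseudo-monoid iff `1 ∈ ι(P)` and
`ι(x)⁻¹ ∈ ι(P)` [both are needed: `{2, 1/2} ⊆ ℚ^×` has no invertible elements].
([IUTchI] Ex 5.1 (v) p.128) [claim: Mochizuki2012, status: disputed] -/
theorem PartialMul.IsRealizedBy.mem_units_iff (hι : μ.IsRealizedBy M ι) (x : P) :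
    x ∈ μ.units ↔ (1 : M) ∈ Set.range ι ∧ (ι x)⁻¹ ∈ Set.range ι := by
  constructor
  · rintro ⟨y, h, hn⟩
    rw [hι.isNeutral_iff] at hn
    have key : ι (μ.op ⟨(x, y), h⟩) = ι x * ι y := hι.op_eq _
    rw [hn] at key
    refine ⟨⟨_, hn⟩, ⟨y, ?_⟩⟩
    rw [eq_inv_iff_mul_eq_one, mul_comm, ← key]
  · rintro ⟨⟨e, he⟩, ⟨y, hy⟩⟩
    have hd : (x, y) ∈ μ.dom := by
      rw [hι.dom_eq]
      change ι x * ι y ∈ Set.range ι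
      rw [hy, mul_inv_cancel]
      exact ⟨e, he⟩
    refine ⟨y, hd, ?_⟩
    have key : ι (μ.op ⟨(x, y), hd⟩) = ι x * ι y := hι.op_eq _
    rw [hι.isNeutral_iff, key, hy, mul_inv_cancel]

/-- For a subset `S` of an abelian group with the restricted group law (`PartialMul.ofSubset`), the
invertible elements are the `x ∈ S` with `x⁻¹ ∈ S` — provided `1 ∈ S`, none otherwise.
([IUTchI] Ex 5.1 (v) p.128) [claim: Mochizuki2012, status: disputed] -/
theorem PartialMul.mem_units_ofSubset_iff (S : Set M) (x : S) :
    x ∈ (PartialMul.ofSubset S).units ↔ (1 : M) ∈ S ∧ (x : M)⁻¹ ∈ S := by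
  have hι : (PartialMul.ofSubset S).IsRealizedBy M Subtype.val :=
    { injective := Subtype.val_injective
      dom_eq := by ext p; simp [PartialMul.ofSubset]
      op_eq := fun _ => rfl }
  rw [hι.mem_units_iff]
  simp

end Units

/-! ### (i)/(v): `(𝕄^⊛_∞κ)^× ⊆ (𝕄^⊛_∞κ×)^× = 𝕄^⊛` (p. 128) on the data of (i) -/

namespace NFBridgeRecon

variable (N : NFBridgeRecon.{u})

/-- `(𝕄^⊛_∞κ(†𝒟^⊚))^×`: the invertible elements of the pseudo-monoid `𝕄^⊛_∞κ(†𝒟^⊚) ⊆ K_rat^×` — the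
`f ∈ 𝕄^⊛_∞κ` with `f⁻¹ ∈ 𝕄^⊛_∞κ` [and `1 ∈ 𝕄^⊛_∞κ`, cf. `PartialMul.mem_units_ofSubset_iff`] (p. 128).
([IUTchI] Ex 5.1 (v) p.128) [claim: Mochizuki2012, status: disputed] -/
def minfκUnits : Set N.Krat := {f | (1 : N.Krat) ∈ N.Minfκ ∧ f ∈ N.Minfκ ∧ f⁻¹ ∈ N.Minfκ}

/-- `(𝕄^⊛_∞κ×(†𝒟^⊚))^×`, likewise (p. 128). ([IUTchI] Ex 5.1 (v) p.128)
[claim: Mochizuki2012, status: disputed] -/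
def minfκxUnits : Set N.Krat := {f | (1 : N.Krat) ∈ N.Minfκx ∧ f ∈ N.Minfκx ∧ f⁻¹ ∈ N.Minfκx}

/-- `(𝕄^⊛_∞κ(†𝒟^⊚))^× ⊆ (𝕄^⊛_∞κ×(†𝒟^⊚))^×` (p. 128) — PROVED from `𝕄^⊛_∞κ ⊆ 𝕄^⊛_∞κ×`.
([IUTchI] Ex 5.1 (v) p.128) [claim: Mochizuki2012, status: disputed] -/
theorem minfκUnits_subset : N.minfκUnits ⊆ N.minfκxUnits := fun _ ⟨h1, hf, hf'⟩ =>
  ⟨N.minfκ_subset h1, N.minfκ_subset hf, N.minfκ_subset hf'⟩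

/-- "`(𝕄^⊛_∞κ×(†𝒟^⊚))^× = 𝕄^⊛(†𝒟^⊚)`" (p. 128; (i) p. 124: "`𝕄^⊛(†𝒟^⊚)` may be identified with a
certain sub-pseudo-monoid of `𝕄^⊛_∞κ×(†𝒟^⊚)`"): the invertible ∞κ×-coric rational functions are the
images of the nonzero constants `𝕄^⊛ = 𝕄̄^⊛ ∖ {0}`.  A predicate on the data, not asserted.
([IUTchI] Ex 5.1 (v) p.128) [claim: Mochizuki2012, status: disputed] -/
@[mk_iff] structure InfκxUnitsEqConstants : Prop where
  eq : N.minfκxUnits = Set.range fun x : N.Mast => N.const (x : N.Fbar)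

end NFBridgeRecon

/-! ### (iv): closedness of the decomposition groups `Π_{𝔭₀}` (p. 126; G7-O2) -/

/-- "We obtain a *closed* subgroup [well-defined up to conjugation] `Π_{𝔭₀} ⊆ π₁(†𝒟^⊛)`" (p. 126): the
decomposition groups recorded in `BirationalData.decomp` are closed.  A predicate on the data (the
sibling structure does not carry it), not asserted. ([IUTchI] Ex 5.1 (iv) p.126)
[claim: Mochizuki2012, status: disputed] -/
@[mk_iff] structure BirationalData.IsClosedDecomp {G : ProfiniteGrp.{u}} (β : BirationalData G) :
    Prop where
  isClosed : ∀ p0 : β.PrimeIdx0, IsClosed (β.decomp p0 : Set G)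

/-! ### (v): Kummer realisations of coric pairs; the uniquely determined isomorphism (pp. 127–128) -/

section Coric

variable {Γ : Type u} [Group Γ] [TopologicalSpace Γ]

namespace CoricPair

/-- Two isomorphisms of pairs with the same underlying map are equal. ([IUTchI] Ex 5.1 (v) p.127)
[claim: Mochizuki2012, status: disputed] -/
theorem Iso.ext' {P Q : CoricPair Γ} {e e' : Iso P Q} (h : ∀ x, e.toEquiv x = e'.toEquiv x) :
    e = e' := by
  cases e; cases e'
  congr
  exact Equiv.ext h

/-- A *Kummer realisation* of a pair `Γ ↷ P` in a `Γ`-module `H` [the container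
`lim_H H¹(H, μ_Ẑ(·))` of p. 127, after an identification of cyclotomes]: an injection `P ↪ H`
realising the partial multiplication (§0) and `Γ`-equivariant ("consideration of Kummer classes …
yields a natural injection of `†𝕄^⊛_∞κ` into `lim_H H¹(H, μ_Ẑ(†𝕄^⊛_∞κ))`", p. 127).  DATA;
TODO-merge:abc-iut-L2-t3 (the Kummer map). ([IUTchI] Ex 5.1 (v) p.127)
[claim: Mochizuki2012, status: disputed] -/
structure KummerRealization (P : CoricPair Γ) (H : Type u) [CommGroup H] [MulAction Γ H] :
    Type u where
  /-- the Kummer map `x ↦ κ(x)` -/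
  toFun : P.carrier → H
  /-- it realises the pseudo-monoid structure (in particular it is injective) -/
  realizes : P.pm.IsRealizedBy H toFun
  /-- it is `Γ`-equivariant -/
  smul : ∀ (g : Γ) (x : P.carrier), toFun (g • x) = g • toFun x

variable {P Q : CoricPair Γ} {H : Type u} [CommGroup H] [MulAction Γ H]

/-- An isomorphism of pairs is *compatible* with Kummer realisations `κ_P`, `κ_Q` in a common
container if `κ_Q ∘ e = κ_P` (p. 128: the isomorphisms "induced" by "the resulting isomorphism
between direct limits of cohomology modules"). ([IUTchI] Ex 5.1 (v) p.128)
[claim: Mochizuki2012, status: disputed] -/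
def Iso.IsCompatible (κP : P.KummerRealization H) (κQ : Q.KummerRealization H) (e : Iso P Q) :
    Prop :=
  ∀ x, κQ.toFun (e.toEquiv x) = κP.toFun x

/-- Compatible isomorphisms are unique (injectivity of the Kummer map of `Q`).
([IUTchI] Ex 5.1 (v) p.128) [claim: Mochizuki2012, status: disputed] -/
theorem Iso.eq_of_isCompatible {κP : P.KummerRealization H} {κQ : Q.KummerRealization H}
    {e e' : Iso P Q} (he : e.IsCompatible κP κQ) (he' : e'.IsCompatible κP κQ) : e = e' :=
  Iso.ext' fun x => κQ.realizes.injective (by rw [he x, he' x])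

namespace KummerRealization

variable (κP : P.KummerRealization H) (κQ : Q.KummerRealization H)

/-- The preimage map `x ↦ κ_Q⁻¹(κ_P(x))` when `κ_P(P) ⊆ κ_Q(Q)`. ([IUTchI] Ex 5.1 (v) p.128)
[claim: Mochizuki2012, status: disputed] -/
noncomputable def transfer (h : Set.range κP.toFun ⊆ Set.range κQ.toFun) (x : P.carrier) :
    Q.carrier :=
  (h (Set.mem_range_self x)).choose

/-- `κ_Q(κ_Q⁻¹(κ_P(x))) = κ_P(x)`. ([IUTchI] Ex 5.1 (v) p.128) [claim: Mochizuki2012, status: disputed] -/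
@[simp] theorem transfer_spec (h : Set.range κP.toFun ⊆ Set.range κQ.toFun) (x : P.carrier) :
    κQ.toFun (transfer κP κQ h x) = κP.toFun x :=
  (h (Set.mem_range_self x)).choose_spec

/-- The isomorphism of pairs `P ⥲ Q` determined by two Kummer realisations with the SAME image
`κ_P(P) = κ_Q(Q) ⊆ H`: `x ↦ κ_Q⁻¹(κ_P(x))`; equivariance and compatibility with the partial
multiplications follow from those of `κ_P`, `κ_Q` (the mechanism behind "unique up to a uniquely
determined isomorphism", p. 128). ([IUTchI] Ex 5.1 (v) p.128) [claim: Mochizuki2012, status: disputed] -/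
noncomputable def isoOfRangeEq (h : Set.range κP.toFun = Set.range κQ.toFun) : Iso P Q where
  toEquiv :=
    { toFun := transfer κP κQ h.subset
      invFun := transfer κQ κP h.symm.subset
      left_inv := fun x => κP.realizes.injective (by rw [transfer_spec, transfer_spec])
      right_inv := fun y => κQ.realizes.injective (by rw [transfer_spec, transfer_spec]) }
  smul g x := κQ.realizes.injective (by
    change κQ.toFun (transfer κP κQ h.subset (g • x)) = κQ.toFun (g • transfer κP κQ h.subset x)
    rw [transfer_spec, κQ.smul, transfer_spec, κP.smul])
  dom p := by
    change p ∈ P.pm.dom ↔ (transfer κP κQ h.subset p.1, transfer κP κQ h.subset p.2) ∈ Q.pm.dom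
    rw [κP.realizes.dom_eq, κQ.realizes.dom_eq]
    simp only [Set.mem_setOf_eq, transfer_spec, h]
  op p := κQ.realizes.injective (by
    change κQ.toFun (transfer κP κQ h.subset (P.pm.op p)) =
      κQ.toFun (Q.pm.op ⟨(transfer κP κQ h.subset p.1.1, transfer κP κQ h.subset p.1.2), _⟩)
    rw [transfer_spec, κP.realizes.op_eq, κQ.realizes.op_eq]
    simp only [transfer_spec])

/-- The isomorphism so determined is compatible with the realisations. ([IUTchI] Ex 5.1 (v) p.128)
[claim: Mochizuki2012, status: disputed] -/
theorem isoOfRangeEq_isCompatible (h : Set.range κP.toFun = Set.range κQ.toFun) :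
    (isoOfRangeEq κP κQ h).IsCompatible κP κQ :=
  fun x => transfer_spec κP κQ h.subset x

/-- **"Unique up to a uniquely determined isomorphism"** (p. 128), print-derived form: two pairs with
continuous `Γ`-action realised by their Kummer maps in the same container with the same image are
related by EXACTLY ONE isomorphism of pairs compatible with the Kummer maps.  PROVED.  [The image
equality is what the unique cyclotome isomorphisms of p. 128 supply — `UniqueCyclotomeIso`: the
induced map is a bijection of `𝕄^⊛_∞κ(†𝒟^⊚)` onto `†𝕄^⊛_∞κ`.] ([IUTchI] Ex 5.1 (v) p.128)
[claim: Mochizuki2012, status: disputed] -/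
theorem existsUnique_iso (h : Set.range κP.toFun = Set.range κQ.toFun) :
    ∃! e : Iso P Q, e.IsCompatible κP κQ :=
  ⟨isoOfRangeEq κP κQ h, isoOfRangeEq_isCompatible κP κQ h,
    fun _ he => Iso.eq_of_isCompatible he (isoOfRangeEq_isCompatible κP κQ h)⟩

/-- In particular: if `Q` is [a structure isomorphic to] the model, so is `P` (existence half of the
boxed display, p. 128). ([IUTchI] Ex 5.1 (v) p.128) [claim: Mochizuki2012, status: disputed] -/
theorem isCoricStructure (h : Set.range κP.toFun = Set.range κQ.toFun) :
    IsCoricStructure Γ Q P :=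
  ⟨⟨isoOfRangeEq κP κQ h⟩⟩

end KummerRealization

end CoricPair

end Coric

/-! ### (v) p. 128, second display: the `†𝕄^⊛`-case cyclotome rigidity (G7-O4) -/

section CyclotomeFamily

/-- The three layers of the `†𝕄^⊛`-case display (p. 128): `⊛` [`𝕄^⊛(†𝒟^⊚) ⥲ †𝕄^⊛`], `sol`
[`𝕄^⊛_sol(†𝒟^⊚) ⥲ †𝕄^⊛_sol`], `mod` [`𝕄^⊛_mod(†𝒟^⊚) ⥲ †𝕄^⊛_mod`]. ([IUTchI] Ex 5.1 (v) p.128)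
[claim: Mochizuki2012, status: disputed] -/
inductive AstLayer
  | ast
  | sol
  | mod
  deriving DecidableEq

/-- INTERFACE DATA extending the sibling's `CyclotomeComparison` to FAMILIES of matched sub-objects:
two cyclotomes `μ₁ = μ^Θ_Ẑ(π₁(†𝒟^⊚))`, `μ₂ = μ_Ẑ(†𝕄^⊛)`, the two Kummer containers `H₁`, `H₂` [direct
limits of cohomology modules], matched sub-objects `im₁ i ⊆ H₁`, `im₂ i ⊆ H₂` (`i : ι`; for p. 128,
`ι = AstLayer`), matched INTEGRAL SUBMONOIDS `int₁ 𝔭 ⊆ H₁` ["relative to the ring structure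
constructed in [AbsTopIII], Theorem 1.9, (e), on the domains": the elements integral for the
valuation `𝔭`] and `int₂ 𝔭 ⊆ H₂` [the `𝒪^⊿_𝔭` of (iv)], indexed by one set `𝔓` of primes [matched via
`Prime(†ℱ^⊛_mod) ⥲ 𝕍_mod`, p. 129], and the map on containers induced by an isomorphism of
cyclotomes.  TODO-merge:abc-iut-L2-t3, abc-iut-L4-t1. ([IUTchI] Ex 5.1 (v) p.128)
[claim: Mochizuki2012, status: disputed] -/
structure CyclotomeComparisonFamily (ι : Type w) (𝔓 : Type w') : Type (max (u + 1) w w') where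
  /-- the two cyclotomes -/
  μ₁ : Type u
  μ₂ : Type u
  [grp₁ : CommGroup μ₁]
  [grp₂ : CommGroup μ₂]
  /-- the two cohomological containers -/
  H₁ : Type u
  H₂ : Type u
  /-- the matched sub-objects -/
  im₁ : ι → Set H₁
  im₂ : ι → Set H₂
  /-- the matched integral submonoids `𝒪^⊿_𝔭` on the two sides -/
  int₁ : 𝔓 → Set H₁
  int₂ : 𝔓 → Set H₂
  /-- the map on containers induced by an isomorphism of cyclotomes -/
  induced : (μ₁ ≃* μ₂) → H₁ → H₂

attribute [instance] CyclotomeComparisonFamily.grp₁ CyclotomeComparisonFamily.grp₂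

namespace CyclotomeComparisonFamily

variable {ι : Type w} {𝔓 : Type w'} (C : CyclotomeComparisonFamily ι 𝔓)

/-- The one-sub-object comparison at the layer `i` (the sibling's `CyclotomeComparison`).
([IUTchI] Ex 5.1 (v) p.128) [claim: Mochizuki2012, status: disputed] -/
def component (i : ι) : CyclotomeComparison where
  μ₁ := C.μ₁
  μ₂ := C.μ₂
  H₁ := C.H₁
  H₂ := C.H₂
  im₁ := C.im₁ i
  im₂ := C.im₂ i
  induced := C.induced

/-- The such-that clause of the display for an isomorphism of cyclotomes `e`: the induced map
"induces isomorphisms" of every matched layer AND is "compatible with the integral submonoids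
`𝒪^⊿_𝔭`" (p. 128). ([IUTchI] Ex 5.1 (v) p.128) [claim: Mochizuki2012, status: disputed] -/
def InducesCompatibleIsos (e : C.μ₁ ≃* C.μ₂) : Prop :=
  (∀ i : ι, Set.BijOn (C.induced e) (C.im₁ i) (C.im₂ i)) ∧
    ∀ 𝔭 : 𝔓, Set.BijOn (C.induced e) (C.int₁ 𝔭) (C.int₂ 𝔭)

end CyclotomeComparisonFamily

/-- **Ex. 5.1 (v), p. 128, second display** (the `†𝕄^⊛` case; data with `ι = AstLayer`): "there exists
a unique isomorphism of cyclotomes `μ^Θ_Ẑ(π₁(†𝒟^⊚)) ⥲ μ_Ẑ(†𝕄^⊛)` such that the resulting isomorphism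
between direct limits of cohomology modules induces isomorphisms `𝕄^⊛(†𝒟^⊚) ⥲ †𝕄^⊛`,
`𝕄^⊛_sol(†𝒟^⊚) ⥲ †𝕄^⊛_sol`, `𝕄^⊛_mod(†𝒟^⊚) ⥲ †𝕄^⊛_mod` [of monoids with continuous `π₁(†𝒟^⊛)`-actions]
in a fashion that is compatible with the integral submonoids `𝒪^⊿_𝔭`" — `∃!` over the whole
such-that clause.  A predicate on the data, not asserted. ([IUTchI] Ex 5.1 (v) p.128)
[claim: Mochizuki2012, status: disputed] -/
@[mk_iff] structure UniqueCyclotomeIsoFamily {ι : Type w} {𝔓 : Type w'}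
    (C : CyclotomeComparisonFamily ι 𝔓) : Prop where
  existsUnique : ∃! e : C.μ₁ ≃* C.μ₂, C.InducesCompatibleIsos e

/-- Uniqueness for ONE layer [the sibling's `UniqueCyclotomeIso`, whose printed ground is
`ℚ_{>0} ∩ Ẑ^× = {1}`] together with the existence of an isomorphism satisfying the whole clause gives
the family statement.  PROVED. ([IUTchI] Ex 5.1 (v) p.128) [claim: Mochizuki2012, status: disputed] -/
theorem UniqueCyclotomeIsoFamily.of_component {ι : Type w} {𝔓 : Type w'}
    (C : CyclotomeComparisonFamily ι 𝔓) (i₀ : ι)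
    (huniq : UniqueCyclotomeIso (C.component i₀)) (hex : ∃ e, C.InducesCompatibleIsos e) :
    UniqueCyclotomeIsoFamily C := by
  obtain ⟨e, he⟩ := hex
  obtain ⟨e₀, -, huniq₀⟩ := huniq.existsUnique
  refine ⟨⟨e, he, fun e' he' => ?_⟩⟩
  have h1 : e' = e₀ := huniq₀ e' (he'.1 i₀)
  have h2 : e = e₀ := huniq₀ e (he.1 i₀)
  rw [h1, h2]

end CyclotomeFamily

end Literature.IUT.HodgeTheaters
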